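import Mathlib
import HarnessLib
import Summits.ValiantsHypothesis.ValiantsHypothesis.Theorems.LacunarySymmetroidMatrixDescartesProductPlusOneTameKCalculus

/-!
# ValiantsHypothesis / LacunarySymmetroid — crux `MatrixDescartes` (stmt-ValiantsHypothesis-18050, V1),
# LINE (A) «product_plus_one», S4″/S5 Euler currency: the TAME SECTOR FOR EVERY K (u-chart, window `d_{K−1} − d_0 ≤ 4(d_1 − d_0)`)

Builds on `…ProductPlusOneTameKCalculus` (`hasDerivAt_tameXi`: in the u-chart `u = x^{d_1−d_0}` the weighted level function
`Ξ_j = (X f_j′ − d_0 f_j)/(x^{d_1−d_0} f_j)` of a TAME factor — bottom coefficient nonzero, SECOND coefficient free, all higher coefficients weakly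
opposite in sign to the bottom one — has a nonpositive derivative throughout the TAME WINDOW `d_{K−1} − d_0 ≤ 4(d_1 − d_0)`, negative unless
`f_j = a_0 X^{d_0}`).  This is p7 g14's tame sector (✓ `tame_sector_class`, K = 3, `a c < 0`, `q ≤ 4p`) for EVERY format `K ≥ 2`:

* `tame_pos_roots_le_one` / `prod_tame_pos_roots_le` — a tame factor is nonzero with at most one positive zero (`f/x^{d_1}` is strictly
  monotone), the product of `m` of them has at most `m`;
* `tameK_euler_pos_roots` — range-indexed shape: `Z₊(X·P′ − (m d_0)·P) ≤ 2m + 1`;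
* ★★ `eulerBound_tameK` — LINE SHAPE (unfolded verbatim as in ✓ `eulerBound_coherentK`), every `K ≥ 2`, every strictly increasing support in the
  tame window, bottom coupling `l₀ = 0`: `Z₊(eulerNumerator d a 0) ≤ 2m + 1`;
* ★ `tameK_sector_classK` — members `Z₊(C c·X^{m d_0} + ∏ f_j) ≤ 2m + 2` (✓ `card_pos_roots_class_le_euler`);
* `eulerBoundK3_tameWeak` / `classRowK3_tameWeak` — the `K = 3` rows (`d 2 − d 0 ≤ 4(d 1 − d 0)`, `a_{j0} ≠ 0`, `a_{j2}` weakly opposite, `a_{j1}`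
  free): the hypotheses of ✓ `eulerBoundK3_tameBottom` (`a_{j0} a_{j2} < 0`) imply them (the closing `example`), constant `2m + 1`.

Honest framing: a sector rung of the research stubs (the every-K u-chart sector; the ratio-4 wall is sharp for the method, see the memo
`pub/val-lit/lmr/NOTE-p7g15-18050-LINEA-incoherent-cell.md` §2); NOT `stub_eulerBoundK3` / `stub_classRowK3` / `stub_polyLaw` / `MatrixDescartes` / B;
`VP ≠ VNP` NOT proved.  No definitions, no named facts.
-/

set_option linter.dupNamespace false

namespace Summit.ValiantsHypothesis.ValiantsHypothesis.Theorems.LacunarySymmetroidMatrixDescartes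

namespace ProductPlusOne

open Polynomial Finset
open scoped BigOperators

/-! ### §C A tame factor has at most one positive zero; the product -/

/-- A tame sparse factor (`c_0 ≠ 0`, `c_1` free, `c_0 c_i ≤ 0` for `i ≥ 2`) is nonzero and has at most ONE positive zero
(`f/x^{d_1} = c_0 x^{−(d_1−d_0)} + c_1 + Σ_{i≥2} c_i x^{d_i−d_1}` is strictly monotone). [folklore] -/
theorem tame_pos_roots_le_one (T : ℕ) (d : ℕ → ℕ) (hd : StrictMono d) (c : ℕ → ℝ)
    (ht : (0 < c 0 ∧ ∀ i, 2 ≤ i → i < T + 2 → c i ≤ 0) ∨ (c 0 < 0 ∧ ∀ i, 2 ≤ i → i < T + 2 → 0 ≤ c i)) :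
    (∑ i ∈ Finset.range (T + 2), C (c i) * X ^ (d i) : ℝ[X]) ≠ 0 ∧
    (((∑ i ∈ Finset.range (T + 2), C (c i) * X ^ (d i) : ℝ[X])).roots.toFinset.filter (fun t => 0 < t)).card ≤ 1 := by
  classical
  -- reduce to a positive bottom coefficient (`roots (−f) = roots f`)
  wlog hpos : 0 < c 0 ∧ ∀ i, 2 ≤ i → i < T + 2 → c i ≤ 0 generalizing c
  · have hneg : 0 < -c 0 ∧ ∀ i, 2 ≤ i → i < T + 2 → -c i ≤ 0 := by
      rcases ht with h | h
      · exact absurd h hpos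
      · exact ⟨by linarith [h.1], fun i hi hiT => by linarith [h.2 i hi hiT]⟩
    have hrel : (∑ i ∈ Finset.range (T + 2), C (-c i) * X ^ (d i) : ℝ[X])
        = -(∑ i ∈ Finset.range (T + 2), C (c i) * X ^ (d i)) := by
      rw [← Finset.sum_neg_distrib]
      exact Finset.sum_congr rfl fun i _ => by rw [C_neg, neg_mul]
    have h := this (fun i => -c i) (Or.inl hneg) hneg
    rw [hrel, roots_neg, neg_ne_zero] at h
    exact h
  obtain ⟨hc0, hup⟩ := hpos
  have hf0 : (∑ i ∈ Finset.range (T + 2), C (c i) * X ^ (d i) : ℝ[X]) ≠ 0 := by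
    intro h
    have := coeff_sparse (T + 2) d hd c 0 (by omega)
    rw [h, coeff_zero] at this
    exact hc0.ne' this.symm
  refine ⟨hf0, ?_⟩
  have hd01 : d 0 < d 1 := hd (by omega)
  -- `h(x) = c_0 / x^{d_1−d_0} + c_1 + Σ_{i<T} c_{i+2} x^{d_{i+2}−d_1}`
  set h : ℝ → ℝ := fun x => c 0 / x ^ (d 1 - d 0) + c 1 + ∑ i ∈ Finset.range T, c (i + 2) * x ^ (d (i + 2) - d 1) with hh
  have hrel : ∀ z : ℝ, 0 < z → (∑ i ∈ Finset.range (T + 2), C (c i) * X ^ (d i) : ℝ[X]).eval z = z ^ (d 1) * h z := by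
    intro z hz
    simp only [eval_finsetSum, eval_mul, eval_C, eval_pow, eval_X, hh]
    rw [Finset.sum_range_succ', Finset.sum_range_succ']
    have hz1 : z ^ (d 1) ≠ 0 := pow_ne_zero _ hz.ne'
    have e0 : c 0 * z ^ (d 0) = z ^ (d 1) * (c 0 / z ^ (d 1 - d 0)) := by
      have hzz : z ^ d 0 * z ^ (d 1 - d 0) = z ^ d 1 := by rw [← pow_add, Nat.add_sub_cancel' hd01.le]
      rw [mul_div_assoc', eq_div_iff (pow_ne_zero _ hz.ne')]
      linear_combination (c 0) * hzz
    have e2 : ∀ i ∈ Finset.range T, c (i + 1 + 1) * z ^ (d (i + 1 + 1)) = z ^ (d 1) * (c (i + 2) * z ^ (d (i + 2) - d 1)) := by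
      intro i _
      have hle : d 1 ≤ d (i + 2) := hd.monotone (by omega)
      have hzz : z ^ d 1 * z ^ (d (i + 2) - d 1) = z ^ d (i + 2) := by rw [← pow_add, Nat.add_sub_cancel' hle]
      rw [show i + 1 + 1 = i + 2 from rfl]
      linear_combination (c (i + 2)) * hzz.symm
    rw [Finset.sum_congr rfl e2, ← Finset.mul_sum, e0]
    ring
  -- `h` is strictly decreasing on `(0, ∞)`
  have hmono : ∀ x y : ℝ, 0 < x → x < y → h y < h x := by
    intro x y hx hxy
    rw [hh]
    have hk : 1 ≤ d 1 - d 0 := Nat.sub_pos_of_lt hd01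
    have hpow : x ^ (d 1 - d 0) < y ^ (d 1 - d 0) := pow_lt_pow_left₀ hxy hx.le (by omega)
    have h1 : c 0 / y ^ (d 1 - d 0) < c 0 / x ^ (d 1 - d 0) := div_lt_div_of_pos_left hc0 (pow_pos hx _) hpow
    have h2 : ∑ i ∈ Finset.range T, c (i + 2) * y ^ (d (i + 2) - d 1)
        ≤ ∑ i ∈ Finset.range T, c (i + 2) * x ^ (d (i + 2) - d 1) := by
      refine Finset.sum_le_sum fun i hi => ?_
      rw [Finset.mem_range] at hi
      have hxy' : x ^ (d (i + 2) - d 1) ≤ y ^ (d (i + 2) - d 1) := pow_le_pow_left₀ hx.le hxy.le _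
      exact mul_le_mul_of_nonpos_left hxy' (hup (i + 2) (by omega) (by omega))
    simp only
    linarith
  rw [Finset.card_le_one]
  intro z₁ hz₁ z₂ hz₂
  rw [Finset.mem_filter, Multiset.mem_toFinset, mem_roots hf0, IsRoot.def] at hz₁ hz₂
  have e1 : h z₁ = 0 := by
    have := hz₁.1; rw [hrel z₁ hz₁.2] at this
    exact (mul_eq_zero.1 this).resolve_left (pow_ne_zero _ hz₁.2.ne')
  have e2 : h z₂ = 0 := by
    have := hz₂.1; rw [hrel z₂ hz₂.2] at this
    exact (mul_eq_zero.1 this).resolve_left (pow_ne_zero _ hz₂.2.ne')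
  by_contra hne
  rcases lt_or_gt_of_ne hne with hlt | hlt
  · have hm' := hmono z₁ z₂ hz₁.2 hlt; rw [e1, e2] at hm'; exact lt_irrefl _ hm'
  · have hm' := hmono z₂ z₁ hz₂.2 hlt; rw [e1, e2] at hm'; exact lt_irrefl _ hm'

/-- The product of `m` tame factors: nonzero, at most `m` positive zeros. [folklore] -/
theorem prod_tame_pos_roots_le {m : ℕ} (T : ℕ) (d : ℕ → ℕ) (hd : StrictMono d) (c : Fin m → ℕ → ℝ)
    (ht : ∀ j, (0 < c j 0 ∧ ∀ i, 2 ≤ i → i < T + 2 → c j i ≤ 0) ∨ (c j 0 < 0 ∧ ∀ i, 2 ≤ i → i < T + 2 → 0 ≤ c j i)) :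
    (∏ j, (∑ i ∈ Finset.range (T + 2), C (c j i) * X ^ (d i) : ℝ[X])) ≠ 0 ∧
    ((∏ j, (∑ i ∈ Finset.range (T + 2), C (c j i) * X ^ (d i) : ℝ[X])).roots.toFinset.filter
      (fun t => 0 < t)).card ≤ m := by
  classical
  have hone := fun j => tame_pos_roots_le_one T d hd (c j) (ht j)
  have hP0 : (∏ j, (∑ i ∈ Finset.range (T + 2), C (c j i) * X ^ (d i) : ℝ[X])) ≠ 0 :=
    Finset.prod_ne_zero_iff.mpr (fun j _ => (hone j).1)
  refine ⟨hP0, ?_⟩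
  have hsub : ((∏ j, (∑ i ∈ Finset.range (T + 2), C (c j i) * X ^ (d i) : ℝ[X])).roots.toFinset.filter (fun t => 0 < t))
      ⊆ Finset.univ.biUnion (fun j =>
        ((∑ i ∈ Finset.range (T + 2), C (c j i) * X ^ (d i) : ℝ[X]).roots.toFinset.filter (fun t => 0 < t))) := by
    intro x hx
    rw [mem_filter, Multiset.mem_toFinset, mem_roots hP0, IsRoot.def, eval_prod, Finset.prod_eq_zero_iff] at hx
    obtain ⟨⟨j, _, hj⟩, hx0⟩ := hx
    rw [mem_biUnion]
    refine ⟨j, mem_univ _, ?_⟩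
    rw [mem_filter, Multiset.mem_toFinset, mem_roots (hone j).1, IsRoot.def]
    exact ⟨hj, hx0⟩
  refine (card_le_card hsub).trans (card_biUnion_le.trans ?_)
  calc ∑ j, (((∑ i ∈ Finset.range (T + 2), C (c j i) * X ^ (d i) : ℝ[X]).roots.toFinset.filter (fun t => 0 < t))).card
      ≤ ∑ _j : Fin m, 1 := Finset.sum_le_sum (fun j _ => (hone j).2)
    _ = m := by simp

/-! ### §D The Euler count: tame members, every format -/

/-- ★ **Tame `(T+2)`-nomials on a common support in the tame window, bottom coupling**: `Z₊(X·P′ − (m·d_0)·P) ≤ 2m + 1`.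
[this file's theorem] -/
theorem tameK_euler_pos_roots {m : ℕ} (T : ℕ) (d : ℕ → ℕ) (hd : StrictMono d) (hwin : d (T + 1) - d 0 ≤ 4 * (d 1 - d 0))
    (c : Fin m → ℕ → ℝ)
    (ht : ∀ j, (0 < c j 0 ∧ ∀ i, 2 ≤ i → i < T + 2 → c j i ≤ 0) ∨ (c j 0 < 0 ∧ ∀ i, 2 ≤ i → i < T + 2 → 0 ≤ c j i)) :
    ((X * derivative (∏ j, (∑ i ∈ Finset.range (T + 2), C (c j i) * X ^ (d i) : ℝ[X]))
        - C ((m : ℝ) * (d 0 : ℝ)) * ∏ j, (∑ i ∈ Finset.range (T + 2), C (c j i) * X ^ (d i) : ℝ[X])).roots.toFinset.filter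
      (fun t => 0 < t)).card ≤ 2 * m + 1 := by
  classical
  rcases Nat.eq_zero_or_pos m with hm | hm
  · subst hm
    simp only [Finset.univ_eq_empty, Finset.prod_empty, derivative_one, mul_zero, zero_sub, mul_one, roots_neg,
      Nat.cast_zero, zero_mul, roots_C, Multiset.toFinset_zero, Finset.filter_empty, Finset.card_empty]
    exact Nat.zero_le _
  obtain ⟨hP0, hZ⟩ := prod_tame_pos_roots_le T d hd c ht
  -- every factor a bottom monomial: the Euler numerator vanishes identically
  by_cases hdeg : ∃ j, ∃ i, 1 ≤ i ∧ i < T + 2 ∧ c j i ≠ 0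
  swap
  · push Not at hdeg
    have hfac : ∀ j, (∑ i ∈ Finset.range (T + 2), C (c j i) * X ^ (d i) : ℝ[X]) = C (c j 0) * X ^ (d 0) := by
      intro j
      rw [Finset.sum_range_succ']
      have : ∑ i ∈ Finset.range (T + 1), C (c j (i + 1)) * X ^ (d (i + 1)) = (0 : ℝ[X]) :=
        Finset.sum_eq_zero fun i hi => by
          rw [hdeg j (i + 1) (by omega) (by have := Finset.mem_range.1 hi; omega)]; simp
      rw [this, zero_add]
    have hP : (∏ j, (∑ i ∈ Finset.range (T + 2), C (c j i) * X ^ (d i) : ℝ[X])) = C (∏ j, c j 0) * X ^ (m * d 0) := by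
      rw [Finset.prod_congr rfl (fun j _ => hfac j), Finset.prod_mul_distrib, map_prod C, Finset.prod_const,
        Finset.card_univ, Fintype.card_fin, ← pow_mul]
      ring_nf
    have hE0 : (X * derivative (∏ j, (∑ i ∈ Finset.range (T + 2), C (c j i) * X ^ (d i) : ℝ[X]))
        - C ((m : ℝ) * (d 0 : ℝ)) * ∏ j, (∑ i ∈ Finset.range (T + 2), C (c j i) * X ^ (d i) : ℝ[X])) = 0 := by
      rw [hP]
      have hc : ((m : ℝ) * (d 0 : ℝ)) = ((m * d 0 : ℕ) : ℝ) := by push_cast; ring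
      rw [hc]
      ext n
      rw [coeff_euler, coeff_zero, coeff_C_mul, coeff_X_pow]
      split_ifs with hn
      · rw [hn]; push_cast; ring
      · ring
    rw [hE0]; simp
  obtain ⟨j₀, i₀, hi₀1, hi₀T, hci₀⟩ := hdeg
  have h := euler_pos_roots_le_general (fun j => (∑ i ∈ Finset.range (T + 2), C (c j i) * X ^ (d i) : ℝ[X])) hP0
    ((m : ℝ) * (d 0 : ℝ)) m hZ ?_
  · exact h.trans (by omega)
  · intro w₁ w₂ hw₁ hw12 hfree h1 h2
    set Ξ : ℝ → ℝ := fun y => ∑ j, (X * derivative (∑ i ∈ Finset.range (T + 2), C (c j i) * X ^ (d i) : ℝ[X])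
        - C ((d 0 : ℕ) : ℝ) * ∑ i ∈ Finset.range (T + 2), C (c j i) * X ^ (d i)).eval y
        / (y ^ (d 1 - d 0) * (∑ i ∈ Finset.range (T + 2), C (c j i) * X ^ (d i) : ℝ[X]).eval y) with hΞ
    have hlevel : ∀ y : ℝ, 0 < y → (∀ j, (∑ i ∈ Finset.range (T + 2), C (c j i) * X ^ (d i) : ℝ[X]).eval y ≠ 0) →
        (∑ j, y * (derivative (∑ i ∈ Finset.range (T + 2), C (c j i) * X ^ (d i) : ℝ[X])).eval y
            / (∑ i ∈ Finset.range (T + 2), C (c j i) * X ^ (d i) : ℝ[X]).eval y) = (m : ℝ) * (d 0 : ℝ) →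
        Ξ y = 0 := by
      intro y hy hfy hl
      have hyw : y ^ (d 1 - d 0) ≠ 0 := pow_ne_zero _ hy.ne'
      have key : Ξ y * y ^ (d 1 - d 0)
          = (∑ j, y * (derivative (∑ i ∈ Finset.range (T + 2), C (c j i) * X ^ (d i) : ℝ[X])).eval y
            / (∑ i ∈ Finset.range (T + 2), C (c j i) * X ^ (d i) : ℝ[X]).eval y) - (m : ℝ) * (d 0 : ℝ) := by
        rw [hΞ]; simp only
        rw [Finset.sum_mul]
        have : ((m : ℝ) * (d 0 : ℝ)) = ∑ _j : Fin m, ((d 0 : ℕ) : ℝ) := by simp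
        rw [this, ← Finset.sum_sub_distrib]
        refine Finset.sum_congr rfl fun j _ => ?_
        have hfj := hfy j
        simp only [eval_sub, eval_mul, eval_X, eval_C]
        field_simp
      rw [hl, sub_self] at key
      exact (mul_eq_zero.1 key).resolve_right hyw
    have hΞ1 : Ξ w₁ = 0 := hlevel w₁ hw₁ (fun j => hfree w₁ ⟨le_rfl, hw12.le⟩ j) h1
    have hΞ2 : Ξ w₂ = 0 := hlevel w₂ (hw₁.trans hw12) (fun j => hfree w₂ ⟨hw12.le, le_rfl⟩ j) h2
    have hderiv : ∀ t ∈ Set.Icc w₁ w₂, ∃ D : ℝ, D < 0 ∧ HasDerivAt Ξ D t := by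
      intro t htI
      have ht0 : 0 < t := hw₁.trans_le htI.1
      choose D hD using fun j => hasDerivAt_tameXi T d hd hwin (c j) (ht j) ht0 (hfree t htI j)
      refine ⟨∑ j, D j, ?_, ?_⟩
      · calc ∑ j, D j < ∑ _j : Fin m, (0 : ℝ) :=
            Finset.sum_lt_sum (fun j _ => (hD j).1) ⟨j₀, Finset.mem_univ _, (hD j₀).2.1 ⟨i₀, hi₀1, hi₀T, hci₀⟩⟩
          _ = 0 := by simp
      · have := HasDerivAt.fun_sum (u := Finset.univ) (fun j _ => (hD j).2.2)
        rw [hΞ]; exact this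
    have hcont : ContinuousOn Ξ (Set.Icc w₁ w₂) := fun t htI => by
      obtain ⟨D, _, hD⟩ := hderiv t htI
      exact hD.continuousAt.continuousWithinAt
    obtain ⟨ξ, hξ, hξ'⟩ := exists_deriv_eq_zero hw12 hcont (hΞ1.trans hΞ2.symm)
    obtain ⟨D, hDneg, hD⟩ := hderiv ξ ⟨hξ.1.le, hξ.2.le⟩
    rw [hD.deriv] at hξ'
    exact hDneg.ne hξ'

/-! ### §E Line shapes -/

/-- ★★ **THE TAME SECTOR, EVERY FORMAT** (line shape; `2 ≤ K`, `d` strictly increasing in the tame window `d_{K−1} − d_0 ≤ 4(d_1 − d_0)`,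
bottom coupling `l₀ = 0`, every factor with a nonzero bottom coefficient, a FREE second coefficient and all higher coefficients weakly opposite
in sign to the bottom one): `Z₊(eulerNumerator d a 0) ≤ 2m + 1`. [this file's theorem] -/
theorem eulerBound_tameK {m K : ℕ} (hK : 2 ≤ K) (d : Fin K → ℕ) (hd : StrictMono d)
    (hwin : d ⟨K - 1, by omega⟩ - d ⟨0, by omega⟩ ≤ 4 * (d ⟨1, by omega⟩ - d ⟨0, by omega⟩)) (a : Fin m → Fin K → ℝ)
    (ht : ∀ j, (0 < a j ⟨0, by omega⟩ ∧ ∀ l : Fin K, 2 ≤ (l : ℕ) → a j l ≤ 0) ∨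
      (a j ⟨0, by omega⟩ < 0 ∧ ∀ l : Fin K, 2 ≤ (l : ℕ) → 0 ≤ a j l)) :
    ((∑ j, (∑ l, C (a j l * ((d l : ℝ) - d ⟨0, by omega⟩)) * X ^ (d l)) * ∏ i ∈ Finset.univ.erase j, (∑ l, C (a i l) * X ^ (d l))
      : ℝ[X]).roots.toFinset.filter (fun t => 0 < t)).card ≤ 2 * m + 1 := by
  classical
  obtain ⟨K', rfl⟩ : ∃ K', K = K' + 2 := ⟨K - 2, by omega⟩
  set dx : ℕ → ℕ := fun i => if h : i < K' + 2 then d ⟨i, h⟩ else d ⟨K' + 1, by omega⟩ + (i - (K' + 1)) with hdx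
  set cx : Fin m → ℕ → ℝ := fun j i => if h : i < K' + 2 then a j ⟨i, h⟩ else 0 with hcx
  have hdx_in : ∀ i (h : i < K' + 2), dx i = d ⟨i, h⟩ := fun i h => by simp only [hdx]; exact dif_pos h
  have hcx_in : ∀ j i (h : i < K' + 2), cx j i = a j ⟨i, h⟩ := fun j i h => by simp only [hcx]; exact dif_pos h
  have hdmono : StrictMono dx := by
    intro i j hij
    by_cases hj : j < K' + 2
    · have hi : i < K' + 2 := by omega
      rw [hdx_in i hi, hdx_in j hj]
      exact hd (Fin.mk_lt_mk.mpr hij)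
    · have ej : dx j = d ⟨K' + 1, by omega⟩ + (j - (K' + 1)) := by simp only [hdx]; exact dif_neg hj
      rw [ej]
      by_cases hi : i < K' + 2
      · rw [hdx_in i hi]
        have : d ⟨i, hi⟩ ≤ d ⟨K' + 1, by omega⟩ := hd.monotone (Fin.mk_le_mk.mpr (by omega))
        omega
      · have ei : dx i = d ⟨K' + 1, by omega⟩ + (i - (K' + 1)) := by simp only [hdx]; exact dif_neg hi
        rw [ei]
        omega
  have hfac : ∀ j, (∑ l, C (a j l) * X ^ (d l) : ℝ[X]) = ∑ i ∈ Finset.range (K' + 2), C (cx j i) * X ^ (dx i) := by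
    intro j
    rw [← Fin.sum_univ_eq_sum_range (fun i => C (cx j i) * X ^ (dx i)) (K' + 2)]
    refine Finset.sum_congr rfl (fun l _ => ?_)
    have hl : (l : ℕ) < K' + 2 := l.isLt
    simp only [hcx, hdx, dif_pos hl, Fin.eta]
  have ht' : ∀ j, (0 < cx j 0 ∧ ∀ i, 2 ≤ i → i < K' + 2 → cx j i ≤ 0) ∨ (cx j 0 < 0 ∧ ∀ i, 2 ≤ i → i < K' + 2 → 0 ≤ cx j i) := by
    intro j
    rcases ht j with ⟨h0, h⟩ | ⟨h0, h⟩
    · refine Or.inl ⟨by rw [hcx_in j 0 (by omega)]; exact h0, fun i hi hiK => ?_⟩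
      rw [hcx_in j i hiK]
      exact h ⟨i, hiK⟩ (by simpa using hi)
    · refine Or.inr ⟨by rw [hcx_in j 0 (by omega)]; exact h0, fun i hi hiK => ?_⟩
      rw [hcx_in j i hiK]
      exact h ⟨i, hiK⟩ (by simpa using hi)
  have hwin' : dx (K' + 1) - dx 0 ≤ 4 * (dx 1 - dx 0) := by
    rw [hdx_in (K' + 1) (by omega), hdx_in 0 (by omega), hdx_in 1 (by omega)]
    have e : (⟨K' + 2 - 1, by omega⟩ : Fin (K' + 2)) = ⟨K' + 1, by omega⟩ := by ext; simp
    rw [e] at hwin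
    exact hwin
  rw [eulerNumerator_eq_general, Finset.prod_congr rfl (fun j _ => hfac j)]
  have h0 : ((d ⟨0, by omega⟩ : ℕ) : ℝ) = (dx 0 : ℝ) := by rw [hdx_in 0 (by omega)]
  rw [h0]
  exact tameK_euler_pos_roots K' dx hdmono hwin' cx ht'

/-- ★ **THE TAME SECTOR, member count, EVERY FORMAT** (line shape, bottom coupling `l₀ = 0`, tame window): `Z₊(C c·X^{m d_0} + ∏ f_j) ≤ 2m + 2`
(✓ `card_pos_roots_class_le_euler` + `eulerBound_tameK`). [this file's theorem] -/
theorem tameK_sector_classK {m K : ℕ} (hK : 2 ≤ K) (d : Fin K → ℕ) (hd : StrictMono d)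
    (hwin : d ⟨K - 1, by omega⟩ - d ⟨0, by omega⟩ ≤ 4 * (d ⟨1, by omega⟩ - d ⟨0, by omega⟩)) (a : Fin m → Fin K → ℝ)
    (ht : ∀ j, (0 < a j ⟨0, by omega⟩ ∧ ∀ l : Fin K, 2 ≤ (l : ℕ) → a j l ≤ 0) ∨
      (a j ⟨0, by omega⟩ < 0 ∧ ∀ l : Fin K, 2 ≤ (l : ℕ) → 0 ≤ a j l)) (c : ℝ) :
    ((C c * X ^ (m * d ⟨0, by omega⟩) + ∏ j, ∑ l, C (a j l) * X ^ (d l) : ℝ[X]).roots.toFinset.filter (fun t => 0 < t)).card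
      ≤ 2 * m + 2 :=
  (card_pos_roots_class_le_euler d a ⟨0, by omega⟩ c).trans (by have := eulerBound_tameK hK d hd hwin a ht; omega)

/-- **The `K = 3` row, Euler currency, WEAK tame hypotheses** (`d 0 < d 1 < d 2`, `d 2 − d 0 ≤ 4(d 1 − d 0)`, bottom coupling; `a_{j0} ≠ 0`,
`a_{j2}` weakly opposite in sign, `a_{j1}` free): `Z₊(eulerNumerator d a 0) ≤ 2m + 1`. [this file's theorem] -/
theorem eulerBoundK3_tameWeak {m : ℕ} (d : Fin 3 → ℕ) (h01 : d 0 < d 1) (h12 : d 1 < d 2) (hwin : d 2 - d 0 ≤ 4 * (d 1 - d 0))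
    (a : Fin m → Fin 3 → ℝ) (ht : ∀ j, (0 < a j 0 ∧ a j 2 ≤ 0) ∨ (a j 0 < 0 ∧ 0 ≤ a j 2)) :
    ((∑ j, (∑ l, C (a j l * ((d l : ℝ) - d 0)) * X ^ (d l)) * ∏ i ∈ Finset.univ.erase j, (∑ l, C (a i l) * X ^ (d l))
      : ℝ[X]).roots.toFinset.filter (fun t => 0 < t)).card ≤ 2 * m + 1 := by
  have hd : StrictMono d := by
    refine Fin.strictMono_iff_lt_succ.2 fun i => ?_
    fin_cases i
    · exact h01
    · exact h12
  have ht' : ∀ j, (0 < a j 0 ∧ ∀ l : Fin 3, 2 ≤ (l : ℕ) → a j l ≤ 0) ∨ (a j 0 < 0 ∧ ∀ l : Fin 3, 2 ≤ (l : ℕ) → 0 ≤ a j l) := by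
    intro j
    rcases ht j with ⟨h0, h2⟩ | ⟨h0, h2⟩
    · refine Or.inl ⟨h0, fun l hl => ?_⟩
      fin_cases l
      · simp at hl
      · simp at hl
      · exact h2
    · refine Or.inr ⟨h0, fun l hl => ?_⟩
      fin_cases l
      · simp at hl
      · simp at hl
      · exact h2
  exact eulerBound_tameK (by norm_num) d hd hwin a ht'

/-- **The `K = 3` row, member count, WEAK tame hypotheses** (bottom coupling): `Z₊(C c·X^{m d 0} + ∏ f_j) ≤ 2m + 2`. [this file's theorem] -/
theorem classRowK3_tameWeak {m : ℕ} (d : Fin 3 → ℕ) (h01 : d 0 < d 1) (h12 : d 1 < d 2) (hwin : d 2 - d 0 ≤ 4 * (d 1 - d 0))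
    (a : Fin m → Fin 3 → ℝ) (ht : ∀ j, (0 < a j 0 ∧ a j 2 ≤ 0) ∨ (a j 0 < 0 ∧ 0 ≤ a j 2)) (c : ℝ) :
    ((C c * X ^ (m * d 0) + ∏ j, ∑ l, C (a j l) * X ^ (d l) : ℝ[X]).roots.toFinset.filter (fun t => 0 < t)).card
      ≤ 2 * m + 2 :=
  (card_pos_roots_class_le_euler d a 0 c).trans (by have := eulerBoundK3_tameWeak d h01 h12 hwin a ht; omega)

/-- the hypotheses of ✓ `eulerBoundK3_tameBottom` (`a_{j0} a_{j2} < 0`) imply the weak tame hypotheses, with constant `2m + 1`. -/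
example {m : ℕ} (d : Fin 3 → ℕ) (h01 : d 0 < d 1) (h12 : d 1 < d 2) (hwin : d 2 - d 0 ≤ 4 * (d 1 - d 0))
    (a : Fin m → Fin 3 → ℝ) (hac : ∀ j, a j 0 * a j 2 < 0) :
    ((∑ j, (∑ l, C (a j l * ((d l : ℝ) - d 0)) * X ^ (d l)) * ∏ i ∈ Finset.univ.erase j, (∑ l, C (a i l) * X ^ (d l))
      : ℝ[X]).roots.toFinset.filter (fun t => 0 < t)).card ≤ 2 * m + 1 := by
  refine eulerBoundK3_tameWeak d h01 h12 hwin a fun j => ?_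
  rcases lt_or_gt_of_ne (show a j 0 ≠ 0 from fun h => by have := hac j; rw [h, zero_mul] at this; exact lt_irrefl 0 this)
    with hneg | hpos
  · exact Or.inr ⟨hneg, by have := hac j; nlinarith⟩
  · exact Or.inl ⟨hpos, by have := hac j; nlinarith⟩

end ProductPlusOne

end Summit.ValiantsHypothesis.ValiantsHypothesis.Theorems.LacunarySymmetroidMatrixDescartes
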